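import Summits.BirchSwinnertonDyer.Rank1Residual.Supersingular.KobayashiMainConjecture
import Summits.BirchSwinnertonDyer.Rank1Residual.X4.KimTamagawaDefect
import Literature.NumberTheory.EllipticCurves.LocalTorsionGoodReductionProofs
import Literature.NumberTheory.EllipticCurves.NonEisensteinPrimeOfSurjective
import Literature.NumberTheory.EllipticCurves.ModularCurvePeriodRatio
import HarnessLib

/-!
# Kolyvagin-system RIGIDITY read through Kobayashi 2003 Thm 7.4, in the ± currency: a Kurihara-number
# certificate ⟹ Kato's main conjecture ⟹ BOTH signed main conjectures — Kim AJM 2026 Thm 1.11 (PUBLISHED)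
# and Castella–Sano 2026 Thm 1 (PREPRINT, OPEN binder) — and the two ENGINE stubs of line `kurihara_rigidity`
# of crux `KobayashiLowerHalfLargeImage` (route `SignedLowerHalves`, item stmt-BirchSwinnertonDyer-19001)
# closed MODULO them (cell `bsd-ssimc`, seat `bsd-line-slh-p1`, lead of the line)

HONEST FRAMING: nothing is asserted about any curve; nothing is booked; BSD is not proved by any of this. Pattern
of `FouquetWan2021_thm51_via_kobayashi74_OPEN` (this directory, `KobayashiMainConjectureX7FouquetWan.lean`) and of
`BurungaleSkinnerTianWan2024_thm13_OPEN` (`KobayashiMainConjecture.lean`): ONE `def … : Prop` per printed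
implication whose conclusion is Kato's main conjecture for `E` over `ℚ_∞`, READ THROUGH Kobayashi's Thm 7.4 in
the tree's ± currency `KobayashiMainConjecture W p ε` — because the tree has no predicate «Kato's main
conjecture for `E` at `p`» (the definition item `defn-KatoMainConjecture` is programme-sized; only the per-datum
interfaces of cell bsd-potss exist) but DOES have the signed main conjecture on the real objects. The Kobayashi
step is PUBLISHED; the Kim step is PUBLISHED (so the first binder is a `[cite]` named fact, no `_holds`, size XL);
the Castella–Sano step is a PREPRINT (so the second binder is a `[claim … under-review]` OPEN hypothesis, NEVER a
theorem). Theorems taking them as explicit hypotheses follow (§2).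

## The printed statements

* C.-H. Kim, *The structure of Selmer groups and the Iwasawa main conjecture for elliptic curves*, Amer. J.
  Math. 148 (2026) 79–129 = arXiv:2203.12159 (held text `paper:arxiv-2203.12159`; arXiv Thm 1.11 = journal
  Thm 1.10, NUMBERING NOTE of `KuriharaNumberKimStructure`), **Theorem 1.11** (p0008), VERBATIM: "Let `E` be an
  elliptic curve over `ℚ` and `p ≥ 5` a prime such that • `ρ̄` is surjective, • the Manin constant is prime
  to `p`, • `E(ℚ_p)[p] = 0`, and • all the Tamagawa factors are prime to `p`. Then the following statements are
  equivalent. (1) `δ̃^{(1)}_n ≠ 0` in `𝔽_p` for some `n ∈ 𝒩₁` with `ν(n) = ord(δ̃^{(1)})`. (2) The mod `p` Kato's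
  Kolyvagin system `κ^{Kato,(1)}` is non-trivial. (3) The Iwasawa main conjecture holds." with Conj. 1.3
  (p0005): "`char_Λ(H¹_Iw(ℚ, T)/Λκ^{Kato,∞}_1) = char_Λ(Sel₀(ℚ_∞, E[p^∞])^∨)`" (Kato's IMC over the cyclotomic
  `ℤ_p`-extension `ℚ_∞/ℚ`, `μ`-part included; no reduction hypothesis at `p`). Note on (1): since
  `ord(δ̃^{(1)}) = min{ν(n) : δ̃^{(1)}_n ≠ 0}`, (1) ⟺ «`δ̃^{(1)}_n ≠ 0` for SOME `n ∈ 𝒩₁`» (as in the sibling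
  `Kim2026/EtaKatoMainConjectureOfUnitKuriharaNumber`).
* F. Castella, T. Sano, *On refined nonvanishing conjectures by Kurihara and Kolyvagin*, arXiv:2601.14504
  (2026; held text `paper:arxiv-2601.14504`), §1.1.1 (p0003): `E/ℚ` WITHOUT CM, `p` odd with (sur) `ρ̄` onto,
  a fixed modular parametrisation `φ` with (manin) `p ∤ c_φ`; `δ_n ∈ ℤ/I_n` from the `Ω_E^+`-normalised modular
  symbols, `𝓜(n) = max{𝓜 : δ_n ∈ p^𝓜 ℤ/I_n}` (`∞` if `δ_n = 0`), `𝓜_r = min{𝓜(n) : ν(n) = r}`,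
  `𝓜_∞(δ) = lim_{(-1)^r = ε} 𝓜_r`; **Theorem 1** (p0004), VERBATIM: "Let `p > 3` be a prime such that (sur) and
  (manin) both hold. Then the following are equivalent: (i) `𝓜_∞(δ) = ord_p(Tam_E)`, and hence Conjecture 2
  holds. (ii) The Iwasawa Main Conjecture (conj:IMC-det) for `ℚ_∞/ℚ` holds." with Prop. 2.2.3 (p0009):
  (conj:IMC-det) ⟺ `char_Λ(H¹(ℤ_S, 𝕋)/Λ·z_∞^{(S)}) = char_Λ(H²(ℤ_S, 𝕋))` "the Iwasawa Main Conjecture formulated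
  by Kato"; proof of (i)⇒(ii) in §2.4 (p0011). ANY reduction type at `p`. FRESHNESS 2026-08-28: arXiv v1 only.
* S. Kobayashi, *Iwasawa theory for elliptic curves at supersingular primes*, Invent. Math. 152 (2003) 1–36
  (held copy `paper:doi-10-1007-s00222-002-0265-4`), standing hypotheses `E/ℚ`, `p` odd of good supersingular
  reduction with `a_p = 0`; **Theorem 7.4** (p. 13), VERBATIM: "The three conjectures, namely, Kato's main
  conjecture (Sect. 5), the even main conjecture and the odd main conjecture (Sect. 4) are equivalent." — proved
  component by component in `η` from the three exact sequences of Thm 6.2, 6.3 and (7.21) and Prop. 7.1 ii); at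
  the trivial component `η = 1` (the cyclotomic `ℤ_p`-extension `ℚ_∞`) it reads: Kato's IMC for `T_pE` over
  `ℚ_∞` ⟺ `Char(X⁺(E/ℚ_∞)) = (L_p⁺(E, X))` ⟺ `Char(X⁻(E/ℚ_∞)) = (L_p⁻(E, X))` (the reading pattern of the tree's
  `Kobayashi2003.thm74_etaEvenMC_iff_etaOddMC`); Thm 7.3 ii) / Thm 1.2: `X^±(E/ℚ_∞)` is `Λ`-torsion. The
  tree's `KobayashiMainConjecture W p ε` (file `KobayashiMainConjecture.lean`) is exactly the conclusion for the
  sign `ε` in the Néron normalisation (`ϖ·L^ε`, `ϖ·Ω_E = Ω⁺_f`), torsion clause included.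

## Readings (weaker than print, never stronger; flags for the referee)

`KR-74-trivial-component`: Thm 7.4 is invoked at `η = 1` only (see above). `KR-IMC-forms`: Kim's (3) (Conj.
1.3: `H¹_Iw/Λκ₁` vs `Sel₀^∨`), Castella–Sano's (conj:IMC-det) (Prop. 2.2.3: `H¹(ℤ_S,𝕋)/Λz^{(S)}` vs
`H²(ℤ_S,𝕋)`) and Kobayashi's §5 form (`Char 𝐇²(T) = Char 𝐇¹(T)/Z(T)` at `η = 1`) are the same conjecture —
Kato's Conj. 12.10 for `T_pE` over `ℚ_∞` (Castella–Sano p0004: "a reformulation of [kato-euler-systems] in terms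
of determinants"; Kobayashi Thm 5.2: "See Kato [7], Theorem 12.5"; Kim §1.2.4); this identification is part of
each binder, as in `FouquetWan2021_thm51_via_kobayashi74_OPEN`. `KR-cyclic-levels`: the certificate is read on
the tree's collection — Kurihara numbers `kuriharaNumber f (p^k) n ψ` of the newform `f` (`Ω⁺_f`-normalised)
at CYCLIC Kolyvagin levels (`IsCyclicKolyvaginLevel`, `#Ẽ(𝔽_ℓ)[p] ≤ p`; flag `Kim2026-(6)-cyclic-reading` of
`Rank1Residual/Additive/N10TwistClauseCastellaSano.lean`, CAVEAT of `KuriharaNumberKimStructure`): for Kim a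
unit at a cyclic level of `𝒩₁` is in particular a witness of (1) (WEAKER fact); for Castella–Sano the printed
`𝓜_∞(δ)` (all levels) is read as the tree's `kuriharaPartialInfty W p f` (cyclic levels), exactly as the
accepted binder `BSTW921c_CastellaSano2026_kimTamagawaDefect_OPEN` reads it (`X4.KimTamagawaDefectAt W p f`).
`KR-period`: Kim's and Castella–Sano's `Ω_E^+`-normalisation and Manin hypothesis are carried, as in every
Kim-type fact of the tree at a good prime (`Kim2022_rankZero_padicValRat_sha_of_kuriharaNumber_ne_zero`, …), by
the period-transfer clause `Ω(W) = u·Ω⁺_f`, `u ∈ ℚ`, `|u|_p = 1` (under which `kuriharaNumber f p n ψ = ū·δ̃_n`,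
divisibility by `p^j` unchanged) — the Manin constant of every curve of the class is prime to a good `p ≥ 5`
with `E[p]` irreducible (Mazur 1978 Cor. 4.1 + no rational `p`-isogeny; Greenberg–Vatsal 2000 Rem. 3.4 = the
tree's named fact `realPeriodRat_eq_unit_mul_plusPeriod`). `KR-t0`: Kim's `E(ℚ_p)[p] = 0` is carried VERBATIM
as the `(t0)` binder `#E(ℚ_p)[p] = 1` of the tree's proof-covered Kim twins and discharged in §2 at a good
supersingular `p` with `a_p = 0` by the tree theorem
`natCard_localPTorsion_eq_one_of_good_of_not_dvd_frobeniusTrace_sub_one`.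

## Contents

§1 the two binders; §2 consumers: the registered ENGINE stubs of line `kurihara_rigidity` (skeleton
`Cruxes/KobayashiLowerHalfLargeImage/Lines/kurihara_rigidity.lean`, reshape r2) with their signatures VERBATIM,
each from its binder plus the period fact — `KuriharaRigidity.signedMC_of_kuriharaPartialInfty_eq_zero`
(engine A) and `KuriharaRigidity.signedMC_of_kimTamagawaDefect` (engine B); and the pair-level corollary
`kobayashiMainConjecture_of_kuriharaUnitAt` (one unit Kurihara number at one cyclic level ⟹ both signs).

References: [Kim2022StructureSelmer] Thm 1.11, Conj 1.3, §1.2, §1.3.5, §1.4.3, §6; [CastellaSano2026] Thm 1,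
Conj 2, Prop 2.2.3, §2.4; [Kobayashi2003] Thm 1.2, Thm 7.3, Thm 7.4 (p. 13), §4, §5; [Mazur1978] Cor 4.1;
[GreenbergVatsal2000] §3 Rem 3.4; [Buyukboduk2009TamagawaDefect] Thm B (orientation: why engine B needs `=`).
-/

set_option autoImplicit false

noncomputable section

open scoped Classical MatrixGroups ModularForm

open CongruenceSubgroup WeierstrassCurve Literature.NumberTheory.EllipticCurves
  Literature.NumberTheory.EllipticCurves.ModularForms
  Literature.NumberTheory.EllipticCurves.Rank1Residual
  Literature.NumberTheory.EllipticCurves.Rank1Residual.Typed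
  Summit.BirchSwinnertonDyer.Rank1Residual.X4

namespace Summit.BirchSwinnertonDyer.Rank1Residual.Supersingular

/-! ### §1 The two binders -/

/-- **NAMED FACT (two PUBLISHED theorems composed) — C.-H. Kim, Amer. J. Math. 148 (2026) Thm 1.11
(1) ⟹ (3), READ THROUGH Kobayashi, Invent. Math. 152 (2003) Thm 7.4, in the ± currency.** Kim Thm 1.11:
for `E/ℚ` and `p ≥ 5` with `ρ̄` surjective, the Manin constant prime to `p`, `E(ℚ_p)[p] = 0` and all Tamagawa
factors prime to `p`, a Kurihara number `δ̃^{(1)}_n ≢ 0 (mod p)` at some `n ∈ 𝒩₁` implies Kato's Iwasawa main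
conjecture for `T_pE` over `ℚ_∞` (Conj. 1.3; proof §6: `κ^{Kato}` primitive ⟹ `κ^{Kato,∞}` `Λ`-primitive
(Büyükboduk) ⟹ IMC (Mazur–Rubin)). Kobayashi Thm 7.4 (good supersingular `p` odd, `a_p = 0`; component
`η = 1`): Kato's main conjecture ⟺ the even main conjecture ⟺ the odd main conjecture. TRANSCRIBED on the
tree's objects: `W` globally minimal, `5 ≤ p` of good reduction with `a_p = 0`, `ρ̄_{W,p}` onto
(`HasSurjectiveModNGaloisRep`), `#W(ℚ_p)[p] = 1` (Kim's third hypothesis, verbatim; automatic here, see §2),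
`p ∤ ∏_ℓ c_ℓ(W)` (`tamagawaProduct`), a newform `f` of `W` with the period transfer `Ω(W) = u·Ω⁺_f`,
`|u|_p = 1` (reading `KR-period`), and the certificate `X4.KuriharaUnitAt W p f` — a CYCLIC Kolyvagin level
`n ∈ 𝒩₁(W,p)` with surjective discrete logarithms `ψ` and `kuriharaNumber f p n ψ ≠ 0` (reading
`KR-cyclic-levels`, weaker than (1)) ⟹ `KobayashiMainConjecture W p ε` for EVERY sign `ε`. Readings
`KR-74-trivial-component`, `KR-IMC-forms` (module docstring). Weaker than print, never stronger. No `_holds`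
(size XL: Kato's Euler system and explicit reciprocity law, Mazur–Rubin and Büyükboduk over `Λ`, Kobayashi's
signed Coleman maps — none in Mathlib).
[cite: Kim2022StructureSelmer, Thm. 1.11 (1) ⟹ (3) (arXiv p. 8; journal Thm. 1.10), Conj. 1.3, §6]
[cite: Kobayashi2003, Thm. 7.4 (p. 13), Thm. 7.3 ii), Thm. 1.2, Conjecture (p. 2) and §4–§5]
[cite: Mazur1978, Cor. 4.1] -/
def Kim2026_thm111_via_kobayashi74 : Prop :=
  ∀ (W : WeierstrassCurve ℚ) [W.IsElliptic] [W.IsGloballyMinimal] (p : ℕ) [Fact p.Prime],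
    5 ≤ p → W.HasGoodReductionAtPrime p → W.frobeniusTrace p = 0 →
    W.HasSurjectiveModNGaloisRep p →
    Nat.card {Q : (W.baseChange ℚ_[p]).toAffine.Point // (p : ℕ) • Q = 0} = 1 →
    ¬ p ∣ W.tamagawaProduct →
    ∀ {N : ℕ} [NeZero N] (f : CuspForm (Gamma0 N) 2), IsNewformOf W f →
    (∃ u : ℚ, ‖(u : ℚ_[p])‖ = 1 ∧ W.realPeriodRat = u * plusPeriod f) →
    KuriharaUnitAt W p f →
    ∀ ε : ℤˣ, KobayashiMainConjecture W p ε

/-- **OPEN HYPOTHESIS — UNREFEREED PREPRINT (Castella–Sano, arXiv:2601.14504, 2026) Thm 1 (i) ⟹ (ii), READ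
THROUGH Kobayashi 2003 Thm 7.4 (published), in the ± currency.** Castella–Sano Thm 1: for `E/ℚ` without CM,
`p > 3` with (sur) `ρ̄` onto and (manin), the equality `𝓜_∞(δ) = ord_p(Tam_E)` (their Conjecture 2 = Kim's
Conjecture 1.10 at the pair) implies the Iwasawa Main Conjecture for `ℚ_∞/ℚ` (Kato's, Prop. 2.2.3) — ANY
reduction type at `p`, any `ord_p(Tam_E)`. Kobayashi Thm 7.4 (good supersingular `p`, `a_p = 0`, `η = 1`):
Kato's main conjecture ⟺ each signed main conjecture. TRANSCRIBED: `W` globally minimal, `5 ≤ p` good with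
`a_p = 0`, `¬ W.HasCM`, `ρ̄_{W,p}` onto, a newform `f` of `W` with the period transfer `Ω(W) = u·Ω⁺_f`,
`|u|_p = 1` (reading `KR-period`), and Kim's Tamagawa-defect identity `X4.KimTamagawaDefectAt W p f`
(`kuriharaPartialInfty W p f = ord_p ∏_ℓ c_ℓ(W)`, reading `KR-cyclic-levels` — the printed EQUALITY, not an
inequality: the `≥` half is in print for one Tamagawa prime only, Büyükboduk 2009 Thm B) ⟹
`KobayashiMainConjecture W p ε` for every sign `ε`. NEVER cite this `Prop` as a theorem (FRESHNESS
2026-08-28: arXiv v1, no journal record); take it as an explicit hypothesis. It is the conjunction «CS Thm 1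
(PRE) ∘ Kobayashi Thm 7.4 (PUB)» stated in the ± currency because no Kato-main-conjecture predicate for `E`
exists in the tree. [claim: CastellaSano2026, status: under-review] [cite: Kobayashi2003, Thm. 7.4 (p. 13)] -/
def CastellaSano2026_thm1_via_kobayashi74_OPEN : Prop :=
  ∀ (W : WeierstrassCurve ℚ) [W.IsElliptic] [W.IsGloballyMinimal] (p : ℕ) [Fact p.Prime],
    5 ≤ p → W.HasGoodReductionAtPrime p → W.frobeniusTrace p = 0 → ¬ W.HasCM →
    W.HasSurjectiveModNGaloisRep p →
    ∀ {N : ℕ} [NeZero N] (f : CuspForm (Gamma0 N) 2), IsNewformOf W f →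
    (∃ u : ℚ, ‖(u : ℚ_[p])‖ = 1 ∧ W.realPeriodRat = u * plusPeriod f) →
    KimTamagawaDefectAt W p f →
    ∀ ε : ℤˣ, KobayashiMainConjecture W p ε

/-! ### §2 Consumers: the two ENGINE stubs of line `kurihara_rigidity`, closed MODULO the binders -/

section Consumers

variable (W : WeierstrassCurve ℚ) [W.IsElliptic] [W.IsGloballyMinimal] (p : ℕ) [hp : Fact p.Prime]

/-- **Kim's third hypothesis is automatic here**: at a good prime `p ≥ 3` with `a_p = 0`,
`#E(ℚ_p)[p] = 1` (`a_p − 1 = −1` is prime to `p`; tree theorem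
`natCard_localPTorsion_eq_one_of_good_of_not_dvd_frobeniusTrace_sub_one`, Silverman VII.2.1/VII.3.1).
[cite: Kim2022StructureSelmer, Prop. 3.2 (PDF p. 15)] -/
theorem natCard_localPTorsion_eq_one_of_frobeniusTrace_eq_zero (hp3 : 3 ≤ p)
    (hgood : W.HasGoodReductionAtPrime p) (hap : W.frobeniusTrace p = 0) :
    Nat.card {Q : (W.baseChange ℚ_[p]).toAffine.Point // (p : ℕ) • Q = 0} = 1 := by
  refine natCard_localPTorsion_eq_one_of_good_of_not_dvd_frobeniusTrace_sub_one W p hp3 hgood ?_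
  rw [hap, zero_sub, Int.dvd_neg]
  intro h
  have h1 : (p : ℤ) ≤ 1 := Int.le_of_dvd one_pos h
  have h2 : 2 ≤ p := hp.out.two_le
  omega

/-- **A unit Kurihara number at one cyclic level gives Kobayashi's main conjecture for both signs, at a good
supersingular `p ≥ 5` with `ρ̄` onto and `p ∤ ∏ c_ℓ`** — GRANTED the binder `Kim2026_thm111_via_kobayashi74`
(`hKK`) and the period fact `realPeriodRat_eq_unit_mul_plusPeriod` (`h5`); `E[p]` irreducible from `ρ̄` onto
(`hasIrreducibleModPGaloisRep_of_hasSurjectiveModNGaloisRep`), `#E(ℚ_p)[p] = 1` by the previous lemma.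
CONDITIONAL; closes nothing. [cite: Kim2022StructureSelmer, Thm. 1.11 (1) ⟹ (3)] [cite: Kobayashi2003, Thm. 7.4 (p. 13)] -/
theorem kobayashiMainConjecture_of_kuriharaUnitAt (hKK : Kim2026_thm111_via_kobayashi74)
    (h5 : realPeriodRat_eq_unit_mul_plusPeriod) (hp5 : 5 ≤ p) (hgood : W.HasGoodReductionAtPrime p)
    (hap : W.frobeniusTrace p = 0) (hs : Surj W p) (htam : ¬ p ∣ W.tamagawaProduct)
    {N : ℕ} [NeZero N] (f : CuspForm (Gamma0 N) 2) (hf : IsNewformOf W f) (hunit : KuriharaUnitAt W p f)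
    (ε : ℤˣ) : KobayashiMainConjecture W p ε :=
  hKK W p hp5 hgood hap hs
    (natCard_localPTorsion_eq_one_of_frobeniusTrace_eq_zero W p (by omega) hgood hap) htam f hf
    (h5 W p hp5 hgood (hasIrreducibleModPGaloisRep_of_hasSurjectiveModNGaloisRep W p hs) f hf) hunit ε

/-- **ENGINE A of line `kurihara_rigidity` — the registered stub `stub_signedMC_of_kuriharaPartialInfty_eq_zero`
with its signature VERBATIM, closed MODULO `Kim2026_thm111_via_kobayashi74` (`hKK`, PUBLISHED ×2) and the
period fact (`h5`).** At `p ≥ 5` good with `a_p = 0`, `ρ̄` onto, `p ∤ ∏ c_ℓ`: if every newform `f` of `W` has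
`∂^{(∞)}(δ̃) = 0`, then `KobayashiMainConjecture W p ε` for every `ε`. The main conjecture's own binders
supply the newform `f` (no modularity fact needed); `∂^{(∞)} = 0` is a unit Kurihara number at a cyclic level
(`kuriharaUnitAt_iff_kuriharaPartialInfty_eq_zero`). CONDITIONAL; closes nothing.
[cite: Kim2022StructureSelmer, Thm. 1.11 (1) ⟹ (3)] [cite: Kobayashi2003, Thm. 7.4 (p. 13)] -/
theorem KuriharaRigidity.signedMC_of_kuriharaPartialInfty_eq_zero (hKK : Kim2026_thm111_via_kobayashi74)
    (h5 : realPeriodRat_eq_unit_mul_plusPeriod) :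
    ∀ (W : WeierstrassCurve ℚ) [W.IsElliptic] [W.IsGloballyMinimal] (p : ℕ) [Fact p.Prime],
      5 ≤ p → W.HasGoodReductionAtPrime p → W.frobeniusTrace p = 0 → Surj W p →
      ¬ p ∣ W.tamagawaProduct →
      (∀ [NeZero (W.conductorNorm ℤ)] (f : CuspForm (Gamma0 (W.conductorNorm ℤ)) 2),
          IsNewformOf W f → kuriharaPartialInfty W p f = 0) →
      ∀ ε : ℤˣ, KobayashiMainConjecture W p ε := by
  intro W _ _ p _ hp5 hgood hap hs htam hcert ε κ γ hκ hγ hγ' _ f hf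
  have hunit : KuriharaUnitAt W p f :=
    (kuriharaUnitAt_iff_kuriharaPartialInfty_eq_zero W p f).mpr (hcert f hf)
  exact kobayashiMainConjecture_of_kuriharaUnitAt W p hKK h5 hp5 hgood hap hs htam f hf hunit ε κ γ hκ hγ
    hγ' f hf

/-- **ENGINE B of line `kurihara_rigidity` — the registered stub `stub_signedMC_of_kimTamagawaDefect` with its
signature VERBATIM, closed MODULO the OPEN binder `CastellaSano2026_thm1_via_kobayashi74_OPEN` (`hCS`, the
Castella–Sano half unrefereed) and the period fact (`h5`).** At `p ≥ 5` good with `a_p = 0`, `E` non-CM, `ρ̄`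
onto: if every newform `f` of `W` has `∂^{(∞)}(δ̃) = ord_p ∏ c_ℓ` (Kim's Conjecture 1.10 at the pair), then
`KobayashiMainConjecture W p ε` for every `ε`. CONDITIONAL; closes nothing.
[claim: CastellaSano2026, status: under-review] [cite: Kobayashi2003, Thm. 7.4 (p. 13)] -/
theorem KuriharaRigidity.signedMC_of_kimTamagawaDefect (hCS : CastellaSano2026_thm1_via_kobayashi74_OPEN)
    (h5 : realPeriodRat_eq_unit_mul_plusPeriod) :
    ∀ (W : WeierstrassCurve ℚ) [W.IsElliptic] [W.IsGloballyMinimal] (p : ℕ) [Fact p.Prime],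
      5 ≤ p → W.HasGoodReductionAtPrime p → W.frobeniusTrace p = 0 → ¬ W.HasCM → Surj W p →
      (∀ [NeZero (W.conductorNorm ℤ)] (f : CuspForm (Gamma0 (W.conductorNorm ℤ)) 2),
          IsNewformOf W f →
            kuriharaPartialInfty W p f = (padicValNat p W.tamagawaProduct : ℕ∞)) →
      ∀ ε : ℤˣ, KobayashiMainConjecture W p ε := by
  intro W _ _ p _ hp5 hgood hap hcm hs hcert ε κ γ hκ hγ hγ' _ f hf
  exact hCS W p hp5 hgood hap hcm hs f hf
    (h5 W p hp5 hgood (hasIrreducibleModPGaloisRep_of_hasSurjectiveModNGaloisRep W p hs) f hf)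
    (hcert f hf) ε κ γ hκ hγ hγ' f hf

end Consumers

/-! ### §3 The `≥` half of Kim's Conjecture 1.10 as a READING of Castella–Sano §2 (appended, lead cycle 1)

Why a third binder. After reshape r2 the line `kurihara_rigidity` has two Kurihara-side stubs on the large-image
corner of X7: the `≤` half `X4.KimTamagawaDefectLeAt` (a NON-VANISHING statement, per pair one finite certificate —
the genuinely open content) and the `≥` half `X4.KimTamagawaDefectGeAt` (a VANISHING statement: every Kurihara
number at every cyclic level is divisible by `p^{min(depth, ord_p Tam_E)}`). The `≥` half is the Euler-system
direction sharpened by ALL Tamagawa factors. In print: (a) for ONE Tamagawa prime, Büyükboduk, JNT 129 (2009) =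
arXiv:0710.3858 Thm B (`κ^{Kato} ∈ p^n KS(T)` if `p^n ∣ c_ℓ`; the full product is his open question); (b) for the
FULL product it is an implicit corollary of Castella–Sano's §2 — NOT a displayed statement there — by running their
proof of Thm 1 (i)⇒(ii) (p0011) with an inequality in place of the equality: the Euler-system divisibility
(eq:upper-div) `char_Λ(H¹(ℤ_S,𝕋)/Λz_∞^{(S)}) ⊂ char_Λ(H²(ℤ_S,𝕋))` ([mazrub], unconditional given `z_∞` non-torsion,
Thm 2.1.2) gives by Remark 2.2.4 the INTEGRALITY `𝔷_{ℚ_∞} ∈ det_Λ^{-1}RΓ(ℤ_S,𝕋)`; specialising at a character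
`α ≡ 1 (mod p^m)`, `m ≫ 0`, through the perfect-control isomorphism and reading the image through Prop. 2.3.1
(`det^{-1}_{ℤ_p}RΓ(ℤ_S,T(α)) ≅ (∏_{ℓ∣Np} #E(ℚ_ℓ)[p^∞])·#H¹_{str}(ℚ,T(α)^*)·H¹(ℤ_S,T(α))`, `ϑ(𝔷(α)) = Eul_N(α)·κ_{1,Λ}(α)`)
and (eq:Euler) (`ord_p Eul_N(α) = ord_p ∏_{ℓ∣N} #Ẽ_ns(𝔽_ℓ)`) — the SAME computation that in Cor. 2.3.2 turns
«basis» into the index EQUALITY — turns «integral» into the index INEQUALITY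
`ind_p(κ_{1,Λ}(α)) ≥ ord_p #E(ℚ_p)[p^∞] + ord_p #H¹_{str}(ℚ,T(α)^*) + ord_p(Tam_E)`; Mazur–Rubin's structure theorem
Thm 2.1.4 (`length H¹_{str} = ind_p(κ_{1,Λ}(α)) − 𝓜_∞(κ_Λ(α))`) then gives `𝓜_∞(κ_Λ(α)) ≥ ord_p #E(ℚ_p)[p^∞] + ord_p(Tam_E)`,
and the chain (eq:chain) (Prop. 2.1.5, Lemma 2.1.1, Thm 2.1.3 = Kim's derived explicit reciprocity law:
`𝓜_∞(κ_Λ(α)) = 𝓜_∞(δ) + ord_p #E(ℚ_p)[p^∞]`) gives `𝓜_∞(δ) ≥ ord_p(Tam_E)`. Every ingredient is displayed in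
[CastellaSano2026] §2 (pp. 7–11); the one-sided conclusion is not, hence the suffix `_implicit_OPEN` and the
`[claim … under-review]` tag: an OPEN hypothesis recording a READING of a PREPRINT, never a theorem. On the
tree's objects the conclusion `𝓜_∞(δ) ≥ ord_p Tam_E` implies `X4.KimTamagawaDefectGeAt W p f` outright (the tree's
`kuriharaPartialInfty` is an infimum over FEWER levels — the cyclic ones — hence `≥ 𝓜_∞(δ)`; reading
`KR-cyclic-levels` is here harmless), under the period transfer `KR-period`. -/

/-- **OPEN HYPOTHESIS — READING of an UNREFEREED PREPRINT (Castella–Sano, arXiv:2601.14504, 2026), §2.2–§2.4: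
the Euler-system INEQUALITY `𝓜_∞(δ) ≥ ord_p(Tam_E)` implicit in the proof of Thm 1** (integrality of `𝔷_{ℚ_∞}`
from (eq:upper-div) + Remark 2.2.4, descended by Prop. 2.3.1 / (eq:Euler), combined with Thm 2.1.4 and (eq:chain);
see the section docstring for the six-line derivation with locators — the inequality itself is NOT displayed in
the source). TRANSCRIBED (restricted to the use of line `kurihara_rigidity`): `W` globally minimal WITHOUT CM,
`5 ≤ p` of good reduction with `a_p = 0` (so `#E(ℚ_p)[p^∞] = 1`), `ρ̄_{W,p}` onto, a newform `f` of `W` with the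
period transfer `Ω(W) = u·Ω⁺_f`, `|u|_p = 1` ⟹ `X4.KimTamagawaDefectGeAt W p f`: every Kurihara number of `f` at
every cyclic Kolyvagin level is divisible by `p^{min(depth, ord_p ∏ c_ℓ)}`. For ONE Tamagawa prime this is in
print (Büyükboduk 2009 Thm B with Kim's derived reciprocity law); for the full product it is Büyükboduk's
question, answered — on this reading — by Castella–Sano's determinant descent. NEVER cite this `Prop` as a
theorem (FRESHNESS 2026-08-28: arXiv v1); take it as an explicit hypothesis; a referee of the reading should
check the orientation of `det^{-1}` on torsion modules against Cor. 2.3.2's own equality.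
[claim: CastellaSano2026, status: under-review] [cite: Buyukboduk2009TamagawaDefect, Thm. B (orientation)] -/
def CastellaSano2026_sec2_tamagawaDefectGe_implicit_OPEN : Prop :=
  ∀ (W : WeierstrassCurve ℚ) [W.IsElliptic] [W.IsGloballyMinimal] (p : ℕ) [Fact p.Prime],
    5 ≤ p → W.HasGoodReductionAtPrime p → W.frobeniusTrace p = 0 → ¬ W.HasCM →
    W.HasSurjectiveModNGaloisRep p →
    ∀ {N : ℕ} [NeZero N] (f : CuspForm (Gamma0 N) 2), IsNewformOf W f →
    (∃ u : ℚ, ‖(u : ℚ_[p])‖ = 1 ∧ W.realPeriodRat = u * plusPeriod f) →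
    KimTamagawaDefectGeAt W p f

section ConsumersGe

/-- **The `≥` stub of line `kurihara_rigidity` — the registered `stub_tamagawa_le_kuriharaPartialInfty_X7` with its
signature VERBATIM — closed MODULO the reading `CastellaSano2026_sec2_tamagawaDefectGe_implicit_OPEN` (`hGe`) and
the period fact `realPeriodRat_eq_unit_mul_plusPeriod` (`h5`).** Good reduction from `ClassX7`; `E[p]` irreducible
from `ρ̄` onto. CONDITIONAL; closes nothing. [claim: CastellaSano2026, status: under-review] -/
theorem KuriharaRigidity.tamagawa_le_kuriharaPartialInfty_X7
    (hGe : CastellaSano2026_sec2_tamagawaDefectGe_implicit_OPEN) (h5 : realPeriodRat_eq_unit_mul_plusPeriod) :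
    ∀ (W : WeierstrassCurve ℚ) [W.IsElliptic] [W.IsGloballyMinimal] (p : ℕ) [Fact p.Prime],
      5 ≤ p → ClassX7 W p → ¬ W.HasCM → W.frobeniusTrace p = 0 → Surj W p →
      ∀ [NeZero (W.conductorNorm ℤ)] (f : CuspForm (Gamma0 (W.conductorNorm ℤ)) 2),
        IsNewformOf W f → (padicValNat p W.tamagawaProduct : ℕ∞) ≤ kuriharaPartialInfty W p f := by
  intro W _ _ p _ hp5 hX hcm hap hs _ f hf
  exact hGe W p hp5 hX.1.1 hap hcm hs f hf
    (h5 W p hp5 hX.1.1 (hasIrreducibleModPGaloisRep_of_hasSurjectiveModNGaloisRep W p hs) f hf)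

/-- **With both Castella–Sano readings, ENGINE B needs only the `≤` half**: at `p ≥ 5` good with `a_p = 0`, `E`
non-CM, `ρ̄` onto, GRANTED `CastellaSano2026_thm1_via_kobayashi74_OPEN` (`hCS`), the reading
`CastellaSano2026_sec2_tamagawaDefectGe_implicit_OPEN` (`hGe`) and the period fact (`h5`): the `≤` half
`X4.KimTamagawaDefectLeAt W p f` for every newform `f` of `W` gives `KobayashiMainConjecture W p ε` for every sign.
CONDITIONAL; closes nothing. [claim: CastellaSano2026, status: under-review] [cite: Kobayashi2003, Thm. 7.4 (p. 13)] -/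
theorem KuriharaRigidity.signedMC_of_kimTamagawaDefectLe (hCS : CastellaSano2026_thm1_via_kobayashi74_OPEN)
    (hGe : CastellaSano2026_sec2_tamagawaDefectGe_implicit_OPEN) (h5 : realPeriodRat_eq_unit_mul_plusPeriod)
    (W : WeierstrassCurve ℚ) [W.IsElliptic] [W.IsGloballyMinimal] (p : ℕ) [Fact p.Prime]
    (hp5 : 5 ≤ p) (hgood : W.HasGoodReductionAtPrime p) (hap : W.frobeniusTrace p = 0) (hcm : ¬ W.HasCM)
    (hs : Surj W p) {N : ℕ} [NeZero N] (f : CuspForm (Gamma0 N) 2) (hf : IsNewformOf W f)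
    (hLe : KimTamagawaDefectLeAt W p f) (ε : ℤˣ) : KobayashiMainConjecture W p ε :=
  have hu := h5 W p hp5 hgood (hasIrreducibleModPGaloisRep_of_hasSurjectiveModNGaloisRep W p hs) f hf
  hCS W p hp5 hgood hap hcm hs f hf hu
    ((kimTamagawaDefectAt_iff W p f).mpr ⟨hLe, hGe W p hp5 hgood hap hcm hs f hf hu⟩) ε

end ConsumersGe

/-! ### §4 The CONVERSE reading (appended, lead cycle 1): a signed main conjecture ⟹ Kim's Conjecture 1.10 at the
pair — Kobayashi Thm 7.4 (one signed MC ⟹ Kato's) ∘ Castella–Sano Thm 1 (ii) ⟹ (i)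

Why. With §1–§3 the crux `KobayashiLowerHalfLargeImage` FOLLOWS from Kim's Conjecture 1.10 on the large-image
corner of X7 (Theorems file `…KuriharaRigidityFacts`). The converse — the crux (one sign's Eisenstein half),
squeezed against Kobayashi Thm 4.1 into that sign's full main conjecture by the tree theorem
`kobayashiMainConjecture_of_lowerDivisibility_of_thm41`, gives back Kim's Conjecture 1.10 — needs the opposite
directions of the same two sources: Kobayashi Thm 7.4 («even MC ⟹ Kato's MC», «odd MC ⟹ Kato's MC») and
Castella–Sano Thm 1 (ii) ⟹ (i) (Kato's IMC ⟹ `𝓜_∞(δ) = ord_p Tam_E`). The binder below types that composite in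
the ± currency (pattern and flags exactly as `CastellaSano2026_thm1_via_kobayashi74_OPEN`; the accepted
`BSTW921c_CastellaSano2026_kimTamagawaDefect_OPEN` of `Rank1Residual/Additive/N10TwistClauseCastellaSano.lean` is the
same (ii) ⟹ (i) reading composed with BSTW instead). With it the Theorems side proves the EQUIVALENCE «crux 3 on
X7 ∧ ¬CM ∧ Surj ∧ p ≥ 5 ⟺ Kim's Conjecture 1.10 there» modulo the named inputs — i.e. the line's open stub is
EXACTLY crux-sized, in Kurihara currency. Reading `KR-cyclic-levels` in its unfavourable direction is part of
the hypothesis here (the printed `𝓜_∞(δ) = t` over all levels is read as the tree's cyclic-level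
`kuriharaPartialInfty = t`, as in the accepted N10 binder; flag `Kim2026-(6)-cyclic-reading`). -/

/-- **OPEN HYPOTHESIS — Kobayashi 2003 Thm 7.4 (PUBLISHED: a signed main conjecture for ONE sign ⟹ Kato's main
conjecture, component `η = 1`) ∘ Castella–Sano arXiv:2601.14504 Thm 1 (ii) ⟹ (i) (UNREFEREED PREPRINT: Kato's IMC
for `ℚ_∞/ℚ` ⟹ `𝓜_∞(δ) = ord_p(Tam_E)`, `p > 3`, `E` non-CM, (sur), (manin)), in the ± currency.** TRANSCRIBED:
`W` globally minimal without CM, `5 ≤ p` good with `a_p = 0`, `ρ̄_{W,p}` onto, a newform `f` of `W` with the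
period transfer `Ω(W) = u·Ω⁺_f`, `|u|_p = 1`; IF `KobayashiMainConjecture W p ε` holds for SOME sign `ε`, THEN
`X4.KimTamagawaDefectAt W p f` (`∂^{(∞)}(δ̃) = ord_p ∏ c_ℓ` on the cyclic levels — reading `KR-cyclic-levels`,
here load-bearing). NEVER cite this `Prop` as a theorem; take it as an explicit hypothesis.
[claim: CastellaSano2026, status: under-review] [cite: Kobayashi2003, Thm. 7.4 (p. 13)] -/
def Kobayashi74_CastellaSano2026_kimTamagawaDefect_of_signedMC_OPEN : Prop :=
  ∀ (W : WeierstrassCurve ℚ) [W.IsElliptic] [W.IsGloballyMinimal] (p : ℕ) [Fact p.Prime],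
    5 ≤ p → W.HasGoodReductionAtPrime p → W.frobeniusTrace p = 0 → ¬ W.HasCM →
    W.HasSurjectiveModNGaloisRep p →
    ∀ {N : ℕ} [NeZero N] (f : CuspForm (Gamma0 N) 2), IsNewformOf W f →
    (∃ u : ℚ, ‖(u : ℚ_[p])‖ = 1 ∧ W.realPeriodRat = u * plusPeriod f) →
    (∃ ε : ℤˣ, KobayashiMainConjecture W p ε) →
    KimTamagawaDefectAt W p f

section ConsumersConverse

/-- **A signed main conjecture at the pair gives Kim's Conjecture 1.10 for every newform of `W`**, GRANTED the
converse binder `Kobayashi74_CastellaSano2026_kimTamagawaDefect_of_signedMC_OPEN` (`hC`) and the period fact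
(`h5`): `p ≥ 5` good, `a_p = 0`, non-CM, `ρ̄` onto. CONDITIONAL; closes nothing.
[claim: CastellaSano2026, status: under-review] [cite: Kobayashi2003, Thm. 7.4 (p. 13)] -/
theorem KuriharaRigidity.kimTamagawaDefectAt_of_signedMC
    (hC : Kobayashi74_CastellaSano2026_kimTamagawaDefect_of_signedMC_OPEN) (h5 : realPeriodRat_eq_unit_mul_plusPeriod)
    (W : WeierstrassCurve ℚ) [W.IsElliptic] [W.IsGloballyMinimal] (p : ℕ) [Fact p.Prime]
    (hp5 : 5 ≤ p) (hgood : W.HasGoodReductionAtPrime p) (hap : W.frobeniusTrace p = 0) (hcm : ¬ W.HasCM)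
    (hs : Surj W p) {ε : ℤˣ} (hMC : KobayashiMainConjecture W p ε)
    {N : ℕ} [NeZero N] (f : CuspForm (Gamma0 N) 2) (hf : IsNewformOf W f) : KimTamagawaDefectAt W p f :=
  hC W p hp5 hgood hap hcm hs f hf
    (h5 W p hp5 hgood (hasIrreducibleModPGaloisRep_of_hasSurjectiveModNGaloisRep W p hs) f hf) ⟨ε, hMC⟩

end ConsumersConverse

end Summit.BirchSwinnertonDyer.Rank1Residual.Supersingular

end
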